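import Literature.AnabelianGeometry.AbsoluteAnabelian.CuspidalizationFactsModelGalSectInstances
import Literature.AnabelianGeometry.AbsoluteAnabelian.AbsTopII.DehnTwistFreeGroupInputs
import HarnessLib

/-!
# [GalSect] Thm. 1.3 (ii), first sentence (`GalSect.Thm_1_3_ii_points`, FACT-LIST F-0104): INSTANCE FORMS

S. Mochizuki, *Galois sections in absolute anabelian geometry*, Nagoya Math. J. **179** (2005) 17–45
[MochizukiGalSect2005], Thm. 1.3 (ii) p. 6 of the kurims manuscript (`paper:url-1b7afe4e6889`): "The subgroup
`D_x` is commensurably terminal in `Π_{X_K}`" (for every closed point `x` of a hyperbolic curve `X_K` over a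
finite extension `K` of `ℚ_p`).  Cell abc-iut, block F (fact-proving wave), seat abc-iut-f-053 (gen 4), KEY row
INST59H3.  PROOF-ONLY companion of `GaloisSectionsFacts.lean` (abc-iut-L4-t16; imported, never edited; no
definition, no instance, no `Prop` fact).

THE ROW.  `GalSect.Thm_1_3_ii_points P` is typed (policy θ, shape (1)) as a PREDICATE on abstract point data
`P : GalSect.PointData E` over an arbitrary extension of profinite groups `E` ("junk data only falsify their own
instance").  The kernel census of abc-iut-F-lit (`plan/LF-KERNEL-STATUS.tsv`, 2026-08-27T12:11Z, col. 14) holds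
for this row: the closure refuter `GalSect.not_forall_thm_1_3_ii_points` / `not_thm_1_3_ii_points_bot`
(abc-iut-f-097: `D_x := 1` in a nontrivial `Π`), and the CONDITIONAL closers `thm_1_3_ii_points_of_isEmpty`
(no points — vacuous) and `thm_1_3_ii_points_of_decomp_eq_top` (hypothesis `∀ x, D_x = Π`) — but NO theorem
whose conclusion HEAD is `Thm_1_3_ii_points …` at a named datum with 0 hypotheses.  This file supplies three:

* `GalSect.thm_1_3_ii_points_topPoint E` — over EVERY extension `E`: the one-point datum with `D_x := Π`
  (closed), flagged algebraic.  DEGENERATE (`C_Π(Π) = Π`), but every binder is inhabited.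
* `GalSect.not_thm_1_3_ii_points_toyModel` — AT THE NAMED TOY INTERFACE `CurveModelSchemaWitness.toyModel k H`
  of abc-iut-f-076 (the carrier the KEY suggests; one closed point with `D := 1` in `Π := G_k × H`) the row
  FAILS as soon as `H` is nontrivial (`C_Π(1) = Π ≠ 1`): recorded so that no seat looks for the positive
  instance there.  (For F-0082/F-0083 the same toy interface DOES work, `CuspidalizationFactsModelGalSectInstances`.)
* `GalSect.thm_1_3_ii_points_cuspAxes` — a NON-DEGENERATE instance: over the GEOMETRIC free profinite carrier
  `Π = Δ := F̂₂` (the tree's model of the geometric fundamental group of a once-punctured elliptic curve /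
  of the tripod, [EtTh] §1; `G := 1`), the two-point datum whose "decomposition groups" are the CUSP AXES
  `b^Ẑ = ⟨η x₁⟩⁻` and `a^Ẑ := ⟨η x₀⟩⁻` — proper (`DehnTwist.eta_zero_not_mem_bAxis`), closed, procyclic
  (`SettingModel.bAxisEquiv : b^Ẑ ≃ₜ* Ẑ`) subgroups of a non-abelian profinite group, COMMENSURABLY TERMINAL by the tree's PROVED [SemiAnbd] Ex. 2.10 / [CombGC] Prop. 1.2 (ii)
  (abc-iut-f-069 `DehnTwist.isCommensurablyTerminal_bAxis`, `…_closure_zpowers_eta_zero`, over abc-iut-L3's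
  `cuspInertia_closure_isCommensurablyTerminal`).  SEMI-SYNTHETIC LABEL: in print these subgroups are CUSPIDAL
  inertia groups of the tripod over an algebraically closed field, here cast as abstract point data; the
  instance shows the typed predicate is satisfied non-trivially (by proper subgroups), nothing more.

HONEST FRAMING: statements about OUR typing of [GalSect] Thm. 1.3 (ii); an instance form ≠ the printed theorem
(decomposition groups of closed points of hyperbolic curves over `p`-adic local fields, objects the tree does not
construct — there the row stays a NAMED INPUT, consumed BY NAME, e.g. by
`TemperedCurve.decompCommensurablyTerminal_of_galSect`).  Refuted-as-schema ≠ refuted-in-print; typed ≠ proved;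
nothing here bears on the disputed [IUTchIII] Cor. 3.12; no side taken.
-/

noncomputable section

open scoped Pointwise

namespace Literature.AnabelianGeometry.AbsoluteAnabelian

namespace GalSect

open AbsTopIII

universe u

/-! ### Instance over every extension: one point with `D_x = Π` -/

/-- **F-0104, INSTANCE FORM over every extension `E`** (DEGENERATE, all binders inhabited): the point datum
with ONE closed point, decomposition group `D_x := Π_{X_K}` (closed) and the point flagged algebraic satisfies
`Thm_1_3_ii_points` — `C_Π(Π) = Π` (`thm_1_3_ii_points_of_decomp_eq_top`).  Consistency of the typing only.
[cite: MochizukiGalSect2005, Thm 1.3 (ii) p.6] -/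
theorem thm_1_3_ii_points_topPoint (E : FundamentalExtension.{u}) :
    Literature.AnabelianGeometry.AbsoluteAnabelian.GalSect.Thm_1_3_ii_points
      (⟨PUnit.{u + 1}, fun _ => ⊤, fun _ => by rw [Subgroup.coe_top]; exact isClosed_univ, fun _ => True⟩ :
        PointData E) :=
  thm_1_3_ii_points_of_decomp_eq_top _ fun _ => rfl

/-! ### At the named toy interface `toyModel k H` the row FAILS -/

/-- **F-0104 AT THE NAMED TOY INTERFACE `CurveModelSchemaWitness.toyModel k H`** (abc-iut-f-076: one curve
over `k`, `Π := G_k × H ↠ G_k`, ONE closed point with `D := 1`): for `H` NONTRIVIAL the point data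
`pointDataOf (toyModel k H) U hclosed` VIOLATE `Thm_1_3_ii_points` (`C_Π(1) = Π ≠ 1`, abc-iut-f-097's
`not_thm_1_3_ii_points_bot`).  So this toy interface is NOT a positive carrier for F-0104 (it is one for
F-0082 / F-0083); the positive instances are `thm_1_3_ii_points_topPoint` and `thm_1_3_ii_points_cuspAxes`.
[cite: MochizukiGalSect2005, Thm 1.3 (ii) p.6] -/
theorem not_thm_1_3_ii_points_toyModel (k : Type) [Field k] [CharZero k] (H : ProfiniteGrp.{0}) [Nontrivial H]
    (U : (CurveModelSchemaWitness.toyModel k H).Curve)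
    (hclosed : ∀ x : (CurveModelSchemaWitness.toyModel k H).Point U,
      IsClosed ((CurveModelSchemaWitness.toyModel k H).decomp U x :
        Set ((CurveModelSchemaWitness.toyModel k H).ext U).arith)) :
    ¬ Literature.AnabelianGeometry.AbsoluteAnabelian.GalSect.Thm_1_3_ii_points
        (pointDataOf (CurveModelSchemaWitness.toyModel k H) U hclosed) := by
  haveI : Nontrivial ((CurveModelSchemaWitness.toyModel k H).ext U).arith :=
    inferInstanceAs (Nontrivial (Field.absoluteGaloisGroup k × H))
  exact not_thm_1_3_ii_points_bot PUnit fun _ => True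

/-! ### A non-degenerate instance: the cusp axes of the free profinite group `F̂₂` -/

open Literature.AnabelianGeometry.EtaleTheta.SettingModel
open Literature.AnabelianGeometry.AbsoluteAnabelian.AbsTopII

/-- **F-0104, NON-DEGENERATE INSTANCE FORM at the geometric free profinite carrier** `Π = Δ := F̂₂ ↠ G := 1`
(the tree's `F₂hat`, [EtTh] §1 model of `Δ_X`; SEMI-SYNTHETIC — `G = 1` is no local field's Galois group):
the two-point datum whose "decomposition groups" are the cusp axes `b^Ẑ` (`SettingModel.bAxis = ⟨η x₁⟩⁻`) and
`a^Ẑ = ⟨η x₀⟩⁻` — proper closed procyclic subgroups of the non-abelian `F̂₂` — satisfies `Thm_1_3_ii_points`: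
both are COMMENSURABLY TERMINAL in `F̂₂` by the tree's proved [SemiAnbd] Ex. 2.10 / [CombGC] Prop. 1.2 (ii)
(`DehnTwist.isCommensurablyTerminal_bAxis`, `DehnTwist.isCommensurablyTerminal_closure_zpowers_eta_zero`).
In print these are cuspidal inertia groups of the tripod, here cast as abstract point data: the typed predicate
is satisfiable by PROPER subgroups; nothing is claimed about decomposition groups of closed points of curves.
[cite: MochizukiGalSect2005, Thm 1.3 (ii) p.6] [cite: MochizukiSemiAnbd2006, Ex. 2.10 p.31] -/
theorem thm_1_3_ii_points_cuspAxes :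
    Literature.AnabelianGeometry.AbsoluteAnabelian.GalSect.Thm_1_3_ii_points
      (E := { arith := F₂hat
              gal := ProfiniteGrp.of PUnit.{1}
              aug := 1
              aug_surjective := fun u => ⟨1, Subsingleton.elim _ _⟩ })
      ⟨Bool, fun b => bif b then bAxis else (Subgroup.zpowers (eta (FreeGroup.of 0))).topologicalClosure,
        fun b => by
          cases b
          · exact Subgroup.isClosed_topologicalClosure _
          · exact isClosed_bAxis,
        fun _ => True⟩ := by
  intro b
  cases b
  · exact DehnTwist.isCommensurablyTerminal_closure_zpowers_eta_zero
  · exact DehnTwist.isCommensurablyTerminal_bAxis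

end GalSect

end Literature.AnabelianGeometry.AbsoluteAnabelian

end
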